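import Summits.QuantumAdvantage.QuantumAdvantage.Theorems.CubicForrelationNearExactIsExactCubicFormR4Partner

/-!
# Crux `CubicForrelation.NearExactIsExact` (stmt-QuantumAdvantage-14043) — E1280-even, R4 branch: TOOLS (block frames of any prefix length,
  persistence of the R4 frame identity, the slice `hF` from the frame identity)

Certificate seat `b2b-cforr-cert` (gen 42).  HONEST FRAMING: kernel-checked bookkeeping (standard axioms), the R4 analogue of
…CubicFormR2PartnerTools / …CubicFormBlockFrame, used by the R4 dispatcher (normal form of the cells' cubic form `t̄₇` by a change of the
`z`-coordinates only).  Nothing about `θ₁₂`; NOT summit progress.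

* `tbk_block_frame` (any prefix length `k`): an invertible `P` on the last `m` coordinates extends to `L = 1_k ⊕ P` on `k + m` coordinates,
  with inverse `1_k ⊕ P⁻¹`, acting on `Fin.append v s` as `Fin.append v (P s)`, and with the expected block entries (…CubicFormBlockFrame
  `tbf_block_frame` is the case `k = 3`).
* `tpw_R4_block_frame_identity`: such an `L` (prefix `5`) keeps the R4 frame identity `κ(y) ⊕ κ(y ⊕ e₀) = y₁y₂ ⊕ y₃y₄` (also after a
  translation `b` vanishing on `e₁..e₄`).
* `tpw_R4_hF_of_frame_identity`: the frame identity and the 3-form law give `hF`: `d(e₀,j,k) = [{j,k} = {e₁,e₂}] + [{j,k} = {e₃,e₄}]`.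

References: this seat lineage (g37 R4-PARTNER §1); folklore linear algebra.  Axioms: the standard three.
-/

set_option linter.dupNamespace false -- D-0017: single-problem summit ⇒ `QuantumAdvantage.QuantumAdvantage` by design

namespace Summit.QuantumAdvantage.QuantumAdvantage.Theorems.CubicForrelation.NearExactIsExact

open Finset
open Literature.Computability.QuantumComplexity
open Literature.Computability.QuantumComplexity.BuzetChailloux (bxor zeroVec bxor_comm bxor_self bxor_zeroVec zeroVec_bxor
  bxor_bxor_cancel_left)

variable {k m : ℕ}

/-! ### Block frames `1_k ⊕ P` -/

/-- **Block frame, any prefix length.**  An invertible `P` (inverse `Pi`) on `m` coordinates extends to `L = 1_k ⊕ P` on `k + m`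
coordinates with inverse `Li = 1_k ⊕ Pi`; `L (v, s) = (v, P s)`, `Li (v, s) = (v, Pi s)`, and the block entries of `L` are `[t = t']`, `0`,
`0`, `P`. [folklore] -/
theorem tbk_block_frame (P Pi : Fin m → Fin m → ZMod 2)
    (hPPi : ∀ ψ ω, (∑ φ, P ψ φ * Pi φ ω) = if ψ = ω then 1 else 0)
    (hPiP : ∀ ψ ω, (∑ φ, Pi ψ φ * P φ ω) = if ψ = ω then 1 else 0) :
    ∃ L Li : Fin (k + m) → Fin (k + m) → ZMod 2,
      (∀ ψ ω, (∑ φ, L ψ φ * Li φ ω) = if ψ = ω then 1 else 0) ∧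
      (∀ ψ ω, (∑ φ, Li ψ φ * L φ ω) = if ψ = ω then 1 else 0) ∧
      (∀ (v : Fin k → Bool) (s : Fin m → Bool),
        (fun ψ => decide ((∑ φ, L ψ φ * (if Fin.append v s φ = true then (1 : ZMod 2) else 0)) = 1)) =
          Fin.append v (fun σ => decide ((∑ σ', P σ σ' * (if s σ' = true then (1 : ZMod 2) else 0)) = 1))) ∧
      (∀ (v : Fin k → Bool) (s : Fin m → Bool),
        (fun ψ => decide ((∑ φ, Li ψ φ * (if Fin.append v s φ = true then (1 : ZMod 2) else 0)) = 1)) =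
          Fin.append v (fun σ => decide ((∑ σ', Pi σ σ' * (if s σ' = true then (1 : ZMod 2) else 0)) = 1))) ∧
      (∀ t t', L (Fin.castAdd m t) (Fin.castAdd m t') = if t = t' then 1 else 0) ∧
      (∀ t σ, L (Fin.castAdd m t) (Fin.natAdd k σ) = 0) ∧ (∀ σ t, L (Fin.natAdd k σ) (Fin.castAdd m t) = 0) ∧
      (∀ σ σ', L (Fin.natAdd k σ) (Fin.natAdd k σ') = P σ σ') := by
  classical
  let blk : (Fin m → Fin m → ZMod 2) → Fin (k + m) → Fin (k + m) → ZMod 2 := fun M ψ φ =>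
    Fin.addCases (fun t => Fin.addCases (fun t' => if t = t' then (1 : ZMod 2) else 0) (fun _ => 0) φ)
      (fun σ => Fin.addCases (fun _ => (0 : ZMod 2)) (fun σ' => M σ σ') φ) ψ
  have hb11 : ∀ M t t', blk M (Fin.castAdd m t) (Fin.castAdd m t') = if t = t' then 1 else 0 := by
    intro M t t'; simp only [blk, Fin.addCases_left]
  have hb12 : ∀ M t σ, blk M (Fin.castAdd m t) (Fin.natAdd k σ) = 0 := by
    intro M t σ; simp only [blk, Fin.addCases_left, Fin.addCases_right]
  have hb21 : ∀ M σ t, blk M (Fin.natAdd k σ) (Fin.castAdd m t) = 0 := by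
    intro M σ t; simp only [blk, Fin.addCases_left, Fin.addCases_right]
  have hb22 : ∀ M σ σ', blk M (Fin.natAdd k σ) (Fin.natAdd k σ') = M σ σ' := by
    intro M σ σ'; simp only [blk, Fin.addCases_right]
  -- products
  have hmul : ∀ (M M' : Fin m → Fin m → ZMod 2) ψ ω, (∑ φ, blk M ψ φ * blk M' φ ω) =
      Fin.addCases (fun t => Fin.addCases (fun t' => if t = t' then (1 : ZMod 2) else 0) (fun _ => 0) ω)
        (fun σ => Fin.addCases (fun _ => (0 : ZMod 2)) (fun σ' => ∑ τ, M σ τ * M' τ σ') ω) ψ := by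
    intro M M' ψ ω
    rw [Fin.sum_univ_add]
    refine Fin.addCases (fun t => ?_) (fun σ => ?_) ψ <;> refine Fin.addCases (fun t' => ?_) (fun σ' => ?_) ω
    · simp only [hb11, hb12, hb21, Fin.addCases_left, mul_zero, sum_const_zero, add_zero]
      simp only [ite_mul, one_mul, zero_mul, sum_ite_eq, mem_univ, if_true]
    · simp only [hb11, hb12, hb22, Fin.addCases_left, Fin.addCases_right, mul_zero, zero_mul, sum_const_zero, add_zero]
    · simp only [hb21, hb22, hb11, Fin.addCases_left, Fin.addCases_right, zero_mul, sum_const_zero, zero_add, mul_zero]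
    · simp only [hb21, hb22, hb12, Fin.addCases_right, zero_mul, sum_const_zero, zero_add]
  -- action on `Fin.append v s`
  have hact : ∀ (M : Fin m → Fin m → ZMod 2) (v : Fin k → Bool) (s : Fin m → Bool),
      (fun ψ => decide ((∑ φ, blk M ψ φ * (if Fin.append v s φ = true then (1 : ZMod 2) else 0)) = 1)) =
        Fin.append v (fun σ => decide ((∑ σ', M σ σ' * (if s σ' = true then (1 : ZMod 2) else 0)) = 1)) := by
    intro M v s
    funext ψ
    rw [Fin.sum_univ_add]
    simp only [Fin.append_left, Fin.append_right]
    refine Fin.addCases (fun t => ?_) (fun σ => ?_) ψ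
    · simp only [hb11, hb12, Fin.append_left, zero_mul, sum_const_zero, add_zero, ite_mul, one_mul, sum_ite_eq, mem_univ, if_true]
      cases v t <;> decide
    · simp only [hb21, hb22, Fin.append_right, zero_mul, sum_const_zero, zero_add]
  refine ⟨blk P, blk Pi, fun ψ ω => ?_, fun ψ ω => ?_, hact P, hact Pi, hb11 P, hb12 P, hb21 P, hb22 P⟩
  · rw [hmul]
    refine Fin.addCases (fun t => ?_) (fun σ => ?_) ψ <;> refine Fin.addCases (fun t' => ?_) (fun σ' => ?_) ω
    · simp only [Fin.addCases_left]
      by_cases h : t = t'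
      · subst h; simp
      · rw [if_neg h, if_neg (fun e => h (Fin.castAdd_inj.mp e))]
    · simp only [Fin.addCases_left, Fin.addCases_right]
      rw [if_neg]; intro e; have := congrArg Fin.val e; simp at this; omega
    · simp only [Fin.addCases_left, Fin.addCases_right]
      rw [if_neg]; intro e; have := congrArg Fin.val e; simp at this; omega
    · simp only [Fin.addCases_right]
      rw [hPPi]
      by_cases h : σ = σ'
      · subst h; simp
      · rw [if_neg h, if_neg (fun e => h (Fin.natAdd_inj k |>.mp e))]
  · rw [hmul]
    refine Fin.addCases (fun t => ?_) (fun σ => ?_) ψ <;> refine Fin.addCases (fun t' => ?_) (fun σ' => ?_) ω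
    · simp only [Fin.addCases_left]
      by_cases h : t = t'
      · subst h; simp
      · rw [if_neg h, if_neg (fun e => h (Fin.castAdd_inj.mp e))]
    · simp only [Fin.addCases_left, Fin.addCases_right]
      rw [if_neg]; intro e; have := congrArg Fin.val e; simp at this; omega
    · simp only [Fin.addCases_left, Fin.addCases_right]
      rw [if_neg]; intro e; have := congrArg Fin.val e; simp at this; omega
    · simp only [Fin.addCases_right]
      rw [hPiP]
      by_cases h : σ = σ'
      · subst h; simp
      · rw [if_neg h, if_neg (fun e => h (Fin.natAdd_inj k |>.mp e))]

/-! ### The R4 frame identity survives block frames -/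

/-- **A block frame `1₅ ⊕ P` keeps the R4 frame identity.**  If `L` on `5 + m` bits has the block entries of `tbk_block_frame` (`1₅` on the
prefix, `0` off-diagonal) and `κ(y) ⊕ κ(y ⊕ e₀) = y₁y₂ ⊕ y₃y₄`, then `κ' := κ(b ⊕ L·)` satisfies the same identity whenever the translation
`b` vanishes at `e₁..e₄` (`L e₀ = e₀` and `(L y)ₜ = yₜ` on the prefix). [this work] -/
theorem tpw_R4_block_frame_identity (κ : (Fin (5 + m) → Bool) → Bool) (L : Fin (5 + m) → Fin (5 + m) → ZMod 2)
    (hyy : ∀ t t', L (Fin.castAdd m t) (Fin.castAdd m t') = if t = t' then 1 else 0)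
    (hys : ∀ t σ, L (Fin.castAdd m t) (Fin.natAdd 5 σ) = 0) (hsy : ∀ σ t, L (Fin.natAdd 5 σ) (Fin.castAdd m t) = 0)
    (hD : ∀ y, (κ y ^^ κ (bxor y (fun l => decide (l = Fin.castAdd m (0 : Fin 5))))) =
      ((y (Fin.castAdd m (1 : Fin 5)) && y (Fin.castAdd m (2 : Fin 5))) ^^ (y (Fin.castAdd m (3 : Fin 5)) && y (Fin.castAdd m (4 : Fin 5)))))
    (b : Fin (5 + m) → Bool)
    (hb1 : b (Fin.castAdd m (1 : Fin 5)) = false) (hb2 : b (Fin.castAdd m (2 : Fin 5)) = false)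
    (hb3 : b (Fin.castAdd m (3 : Fin 5)) = false) (hb4 : b (Fin.castAdd m (4 : Fin 5)) = false) :
    ∀ y, ((κ (bxor b (fun ψ => decide ((∑ φ, L ψ φ * (if y φ = true then (1 : ZMod 2) else 0)) = 1)))) ^^
        (κ (bxor b (fun ψ => decide ((∑ φ, L ψ φ *
          (if (bxor y (fun l => decide (l = Fin.castAdd m (0 : Fin 5)))) φ = true then (1 : ZMod 2) else 0)) = 1))))) =
      ((y (Fin.castAdd m (1 : Fin 5)) && y (Fin.castAdd m (2 : Fin 5))) ^^ (y (Fin.castAdd m (3 : Fin 5)) && y (Fin.castAdd m (4 : Fin 5)))) := by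
  -- `L e₀ = e₀`
  have hLe0 : (fun ψ => decide ((∑ φ, L ψ φ *
      (if (fun l => decide (l = Fin.castAdd m (0 : Fin 5))) φ = true then (1 : ZMod 2) else 0)) = 1)) =
      fun l => decide (l = Fin.castAdd m (0 : Fin 5)) := by
    have h := tct_lin_single L (Fin.castAdd m (0 : Fin 5))
    have h' : (fun ψ => decide ((∑ φ, L ψ φ *
        (if (fun l => decide (l = Fin.castAdd m (0 : Fin 5))) φ = true then (1 : ZMod 2) else 0)) = 1)) =
        fun ψ => decide ((∑ φ', L ψ φ' * (if decide (φ' = Fin.castAdd m (0 : Fin 5)) = true then (1 : ZMod 2) else 0)) = 1) := rfl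
    rw [h', h]
    funext ψ
    refine Fin.addCases (fun t => ?_) (fun σ => ?_) ψ
    · rw [hyy]
      by_cases ht : t = 0
      · subst ht; simp
      · have hne : Fin.castAdd m t ≠ Fin.castAdd m (0 : Fin 5) := fun h => ht (by
          have := congrArg Fin.val h; simp only [Fin.val_castAdd] at this; exact Fin.ext this)
        simp [ht, hne]
    · rw [hsy]
      have hne : Fin.natAdd 5 σ ≠ Fin.castAdd m (0 : Fin 5) := fun h => by
        have := congrArg Fin.val h; simp only [Fin.val_natAdd, Fin.val_castAdd] at this; omega
      simp [hne]
  -- `(b ⊕ L y)_t = y_t` on the prefix where `b` vanishes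
  have hcoord : ∀ (y : Fin (5 + m) → Bool) (t : Fin 5), b (Fin.castAdd m t) = false →
      (bxor b (fun ψ => decide ((∑ φ, L ψ φ * (if y φ = true then (1 : ZMod 2) else 0)) = 1))) (Fin.castAdd m t) =
        y (Fin.castAdd m t) := by
    intro y t hbt
    show (b (Fin.castAdd m t) ^^ decide ((∑ φ, L (Fin.castAdd m t) φ * (if y φ = true then (1 : ZMod 2) else 0)) = 1)) = _
    rw [hbt, Bool.false_xor, Fin.sum_univ_add]
    have h2 : (∑ σ : Fin m, L (Fin.castAdd m t) (Fin.natAdd 5 σ) * (if y (Fin.natAdd 5 σ) = true then (1 : ZMod 2) else 0)) = 0 :=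
      Finset.sum_eq_zero fun σ _ => by rw [hys, zero_mul]
    have h1 : (∑ t' : Fin 5, L (Fin.castAdd m t) (Fin.castAdd m t') * (if y (Fin.castAdd m t') = true then (1 : ZMod 2) else 0)) =
        if y (Fin.castAdd m t) = true then (1 : ZMod 2) else 0 := by
      rw [Finset.sum_eq_single t]
      · rw [hyy, if_pos rfl, one_mul]
      · intro t' _ ht'; rw [hyy, if_neg (Ne.symm ht'), zero_mul]
      · intro h; exact absurd (mem_univ t) h
    rw [h1, h2, add_zero]
    cases y (Fin.castAdd m t) <;> decide
  intro y
  rw [tct_lin_bxor L y, hLe0]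
  have hassoc : bxor b (bxor (fun ψ => decide ((∑ φ, L ψ φ * (if y φ = true then (1 : ZMod 2) else 0)) = 1))
      (fun l => decide (l = Fin.castAdd m (0 : Fin 5)))) =
      bxor (bxor b (fun ψ => decide ((∑ φ, L ψ φ * (if y φ = true then (1 : ZMod 2) else 0)) = 1)))
        (fun l => decide (l = Fin.castAdd m (0 : Fin 5))) := (iw_bxor_assoc _ _ _).symm
  rw [hassoc, hD, hcoord y 1 hb1, hcoord y 2 hb2, hcoord y 3 hb3, hcoord y 4 hb4]

/-! ### The slice `hF` from the frame identity -/

/-- **`hF` from the R4 frame identity.**  If `d` is the cubic form of `κ` at unit vectors (3-form law `hd`) and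
`κ(y) ⊕ κ(y ⊕ e₀) = y₁y₂ ⊕ y₃y₄`, then `d(e₀,j,k) = [{j,k} = {e₁,e₂}] + [{j,k} = {e₃,e₄}]`. [this work] -/
theorem tpw_R4_hF_of_frame_identity (κ : (Fin (5 + m) → Bool) → Bool) (d : Fin (5 + m) → Fin (5 + m) → Fin (5 + m) → ZMod 2)
    (hd : ∀ φ j k, d φ j k =
      if ((((κ zeroVec ^^ κ (bxor zeroVec (fun l => decide (l = k)))) ^^
            (κ (bxor zeroVec (fun l => decide (l = j))) ^^ κ (bxor (bxor zeroVec (fun l => decide (l = j))) (fun l => decide (l = k))))) ^^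
          ((κ (bxor zeroVec (fun l => decide (l = φ))) ^^ κ (bxor (bxor zeroVec (fun l => decide (l = φ))) (fun l => decide (l = k)))) ^^
            (κ (bxor (bxor zeroVec (fun l => decide (l = φ))) (fun l => decide (l = j))) ^^
              κ (bxor (bxor (bxor zeroVec (fun l => decide (l = φ))) (fun l => decide (l = j))) (fun l => decide (l = k))))))) = true
      then 1 else 0)
    (hD : ∀ y, (κ y ^^ κ (bxor y (fun l => decide (l = Fin.castAdd m (0 : Fin 5))))) =
      ((y (Fin.castAdd m (1 : Fin 5)) && y (Fin.castAdd m (2 : Fin 5))) ^^ (y (Fin.castAdd m (3 : Fin 5)) && y (Fin.castAdd m (4 : Fin 5))))) :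
    ∀ j k, d (Fin.castAdd m (0 : Fin 5)) j k =
      (if (j = Fin.castAdd m (1 : Fin 5) ∧ k = Fin.castAdd m (2 : Fin 5)) ∨ (j = Fin.castAdd m (2 : Fin 5) ∧ k = Fin.castAdd m (1 : Fin 5))
        then 1 else 0) +
      (if (j = Fin.castAdd m (3 : Fin 5) ∧ k = Fin.castAdd m (4 : Fin 5)) ∨ (j = Fin.castAdd m (4 : Fin 5) ∧ k = Fin.castAdd m (3 : Fin 5))
        then 1 else 0) := by
  have hne : ∀ s t : Fin 5, s ≠ t → (Fin.castAdd m s) ≠ Fin.castAdd m t := fun s t hst h => hst (Fin.castAdd_injective _ _ h)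
  intro j k
  have h1 : d (Fin.castAdd m (0 : Fin 5)) j k = d j k (Fin.castAdd m (0 : Fin 5)) := by
    rw [hd (Fin.castAdd m (0 : Fin 5)) j k, hd j k (Fin.castAdd m (0 : Fin 5)),
      tcf_third_swap12 κ (fun l => decide (l = Fin.castAdd m (0 : Fin 5))) (fun l => decide (l = j)) (fun l => decide (l = k)) zeroVec,
      tcf_third_swap23 κ (fun l => decide (l = j)) (fun l => decide (l = Fin.castAdd m (0 : Fin 5))) (fun l => decide (l = k)) zeroVec]
  rw [h1, hd j k (Fin.castAdd m (0 : Fin 5)),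
    tpw_third_of_r4_slice κ (fun l => decide (l = Fin.castAdd m (0 : Fin 5))) (Fin.castAdd m (1 : Fin 5)) (Fin.castAdd m (2 : Fin 5))
      (Fin.castAdd m (3 : Fin 5)) (Fin.castAdd m (4 : Fin 5)) hD (fun l => decide (l = j)) (fun l => decide (l = k)) zeroVec]
  have hsplit : ∀ A B : Bool, (if (A ^^ B) = true then (1 : ZMod 2) else 0) =
      (if A = true then (1 : ZMod 2) else 0) + (if B = true then (1 : ZMod 2) else 0) := by decide
  rw [hsplit]
  have hAC12 : (decide (Fin.castAdd m (1 : Fin 5) = j) && decide (Fin.castAdd m (2 : Fin 5) = j)) = false := by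
    by_cases hj : Fin.castAdd m (1 : Fin 5) = j
    · have hj' : ¬ Fin.castAdd m (2 : Fin 5) = j := fun h' => hne 1 2 (by decide) (hj.trans h'.symm)
      rw [decide_eq_false hj', Bool.and_false]
    · rw [decide_eq_false hj, Bool.false_and]
  have hAC34 : (decide (Fin.castAdd m (3 : Fin 5) = j) && decide (Fin.castAdd m (4 : Fin 5) = j)) = false := by
    by_cases hj : Fin.castAdd m (3 : Fin 5) = j
    · have hj' : ¬ Fin.castAdd m (4 : Fin 5) = j := fun h' => hne 3 4 (by decide) (hj.trans h'.symm)
      rw [decide_eq_false hj', Bool.and_false]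
    · rw [decide_eq_false hj, Bool.false_and]
  have hkey : ∀ (s s' : Fin 5), (decide (Fin.castAdd m s = j) && decide (Fin.castAdd m s' = j)) = false →
      (if ((decide (Fin.castAdd m s = j) && decide (Fin.castAdd m s' = k)) ^^
            (decide (Fin.castAdd m s' = j) && decide (Fin.castAdd m s = k))) = true then (1 : ZMod 2) else 0) =
        if (j = Fin.castAdd m s ∧ k = Fin.castAdd m s') ∨ (j = Fin.castAdd m s' ∧ k = Fin.castAdd m s) then 1 else 0 := by
    intro s s' hAC
    have key : ∀ A B C D : Bool, (A && C) = false →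
        ((if ((A && B) ^^ (C && D)) = true then (1 : ZMod 2) else 0) =
          if (A = true ∧ B = true) ∨ (C = true ∧ D = true) then 1 else 0) := by decide
    rw [key _ _ _ _ hAC]
    simp only [decide_eq_true_eq]
    have hiff : ((Fin.castAdd m s = j ∧ Fin.castAdd m s' = k) ∨ (Fin.castAdd m s' = j ∧ Fin.castAdd m s = k)) ↔
        ((j = Fin.castAdd m s ∧ k = Fin.castAdd m s') ∨ (j = Fin.castAdd m s' ∧ k = Fin.castAdd m s)) := by
      constructor
      · rintro (⟨h1, h2⟩ | ⟨h1, h2⟩)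
        · exact Or.inl ⟨h1.symm, h2.symm⟩
        · exact Or.inr ⟨h1.symm, h2.symm⟩
      · rintro (⟨h1, h2⟩ | ⟨h1, h2⟩)
        · exact Or.inl ⟨h1.symm, h2.symm⟩
        · exact Or.inr ⟨h1.symm, h2.symm⟩
    simp only [hiff]
  rw [hkey 1 2 hAC12, hkey 3 4 hAC34]

end Summit.QuantumAdvantage.QuantumAdvantage.Theorems.CubicForrelation.NearExactIsExact
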